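import Summits.QuantumFields.BalabanUV.T4Continuum.Support.NE9BridgeSizeInduction
import Literature.MathematicalPhysics.QuantumFieldTheory.Balaban1983to89.T4BoundaryCarrier

/-!
# NE9 — the coupling-two-point ENDs applied to BOUNDARY FAMILIES and to g_j^{κ₀}-weighted (R-type) families on
# sub-windows (row NE9, crew item P2-F7 «records»)

Cell `pub-balaban`, T⁴ rung-(B)+1 cell, row NE9 (node U3: joint Lipschitz dependence of the one-step outputs on the
coupling HISTORY, with fading memory), formalisation swarm seat `b2b-balaban-t4-ne9-formalise-leaf-05` (LEAF PROVER 05),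
crew item **P2-F7** of the merged list of `t4/T4-NE9-TRIGGER.json` (skeleton `t4/skeletons/NE9-t4-ne9-p2.md` §4 F7:
*"R^{(j)} and boundary pieces: E1/E2 applied verbatim with E₀ ↦ R₁g_j^{κ₀} on sub-windows; `T4BoundaryCarrier.NE9Fl`
one-liner for the boundary family"*; `T4HistoryLipschitzRecursion` header: *"Boundary functionals … and the recent-scale
terms R^{(j)} are covered by applying the theorems below to `atFl B a` at each admissible pending field `a`, resp. to the
R-family, as `Functional`s"* — this module is that application as kernel statements, nothing more).

HONEST FRAMING (T4-DAG page 1, verbatim): rung (B)+1 = existence AND uniqueness of the ε → 0 limit of gauge-invariant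
observables on a FIXED finite torus T⁴ — NOT infinite volume, NOT a mass gap, NOT the Clay problem.  HONEST DEPENDENCY
(verbatim): «continuum YM on T⁴ ⇐ BetaPertH ∧ nine spine estimates (0/9 proved); BetaPertH ⇐ (D1) ∧ (D4) ∧ CAP+tail;
G-an2-4 gates asym, D1 and NE2/3/4.»  NE9 is NOT PROVED here or anywhere in the tree; this file is RECORDS-LEVEL
BOOKKEEPING: it instantiates NOTHING on Bałaban's objects, discharges NO binder of the row's END
`NE9LastCouplingBridge.ne9_and_fadingMemory_of_couplingTwoPoint`, and asserts nothing printed in the manuscripts under audit.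

WHAT IS HERE ([folklore] throughout; no `def`, no `def … : Prop`, no END face re-wired — imports BY NAME only).
§1 SUB-WINDOWS.  `T4OutputRate.Window` is monotone in its ceiling; `NE9`, `DecayBound`, `NE9Fl`, `DecayBoundFl` are
   antitone in the window (a sub-window inherits every modulus/constant); history moduli may be enlarged.
§2 THE g_j^{κ₀}-WEIGHTED (R-TYPE) DICTIONARY «E₀ ↦ R₁γ^{κ₀}».  Printed CONTEXT only ([III] = [Balaban1988Convergent] p. 260,
   read on the ×2 render `b2b-balaban-ref1/pages/…-p018-x2.png` by this seat): *"we assume that the following stronger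
   inequality holds: |𝐑^{(j)}(X, (𝐔, 𝐉))| ≤ g_j^{κ₀} exp(−κd_j(X)). (2.31) Here κ₀ can be chosen arbitrarily large, similarly
   as κ, if the other parameters are fixed properly, as in [I]. […] After the vacuum energy renormalization we obtain a sum
   of marginal terms, i.e., terms with bounds O(1)(L^jη)⁴g_j^{κ₀} exp(−κd_j(X)). […] The sum over j is controlled by
   g_j^{κ₀}."*  A g_j^{κ₀}-WEIGHTED size is a HYPOTHESIS SHAPE below (never asserted); on a window `Window γ` (all
   coordinates in ]0, γ]) it yields the g-UNIFORM size binders of the ENDs with the constant `R₁·γ^{κ₀}` — the (B0)/(X) data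
   of `NE9BridgeSizeInduction.ne9_and_fadingMemory_of_couplingTwoPoint_sizeInduction` and `T4OutputRate.DecayBound` — and
   g-WEIGHTED history moduli majorised uniformly on the window give `NE9` (the typed NE9 has g-independent moduli, which is
   *stronger in form* than g_j^{κ₀}-weighted moduli — skeleton P2 §5 (g4); on a sub-window `Window γ′`, γ′ ≤ γ, the
   constant improves to `R₁·γ′^{κ₀}`).
§3 BOUNDARY FAMILIES.  For a boundary-piece functional `Bd : T4BoundaryCarrier.BFunctional C Bg` (background AND pending
   fluctuation field; (2.41) p. 261 of [III]) the row's ROOT END and its occupation-free face are applied AT EACH ADMISSIBLE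
   PENDING FIELD `f ∈ C.admFl`, with the one-step model data (admissible class, channel, new-term map, activities,
   admissible tables, majorant, reading, explicit part) allowed to depend on `f` and the CONSTANTS uniform in `f` (the
   printed situation: (2.42) p. 261 *"|𝐁^{(j)}(X, (𝐔, 𝐉), A, {S_i∩X})| < B₀ exp(−κd_j(X))"* is uniform in A): conclusion
   LITERALLY `T4BoundaryCarrier.NE9Fl Bd W κ (prodModuli ℓ (fun _ => ω′)) ∧ T4OutputRate.FadingMemory (ℓ/ω′) ω′ (…)` with the
   END's `ℓ = 4·clipbar·B + pexbar + 4·lipbar·B·qTbar`, `ω′ = ω + 4·lipbar·B·τ̄` — the pair node U5's term-wise boundary member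
   `T4TermwiseBoundary` (binders `h9`, `hΛ`) and `T4BoundaryCarrier.u3B_threeBrackets` consume BY NAME.  One extra scalar
   binder `0 ≤ lipbar` (in the END it follows from `TwoPointKP` at some pending field; the family may be empty).
§4 NON-VACUITY of the conclusion shape (coupling-free family; `T4BoundaryCarrier.ne9Fl_of_couplingFree`).

CITATION HEADER.  T. Bałaban, *Convergent renormalization expansions for lattice gauge theories*, Commun. Math. Phys.
**119**, 243–285 (1988) [Balaban1988Convergent] = cell paper B14 = [III] (held `paper:balaban1988-cmp119-convergent-
renormalization`, journal page = PDF page + 242); T. Bałaban, *Renormalization group approach to lattice gauge field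
theories. I*, Commun. Math. Phys. **109**, 249–301 (1987) [Balaban1987RG1] (the window ]0, γ], Thm 1 p. 259 — through
`T4OutputRate.Window`).  Both are manuscripts UNDER ADJUDICATION by the cell: quoted for CONTEXT of hypothesis shapes only;
no step of theirs is used.  Mathematical content: monotonicity of `x ↦ x^{κ₀}` on [0, ∞), set inclusion, one application of
two tree theorems per pending field, `fadingMemory_geometric`.  Value = bookkeeping closing crew item P2-F7; NOT NE9, NOT
summit progress; spine PROVED 0/9 unchanged.
-/

namespace Summit.QuantumFields.BalabanUV.T4Continuum.NE9BoundaryFamily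

open scoped BigOperators
open Literature.Probability.LatticeModels
open Literature.MathematicalPhysics.QuantumFieldTheory.Balaban1983to89
open Literature.MathematicalPhysics.QuantumFieldTheory.Balaban1983to89.T4OutputRate
open Literature.MathematicalPhysics.QuantumFieldTheory.Balaban1983to89.T4ActivityLipschitz
open Literature.MathematicalPhysics.QuantumFieldTheory.Balaban1983to89.T4HistoryLipschitzRecursion
open Literature.MathematicalPhysics.QuantumFieldTheory.Balaban1983to89.T4HistoryLipschitzOuter
open Literature.MathematicalPhysics.QuantumFieldTheory.Balaban1983to89.T4HistoryLipschitzActivity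
open Literature.MathematicalPhysics.QuantumFieldTheory.Balaban1983to89.T4HistoryLipschitzActivity (ClusterGeom)
open Literature.MathematicalPhysics.QuantumFieldTheory.Balaban1983to89.T4HistoryLipschitzSegment
open Literature.MathematicalPhysics.QuantumFieldTheory.Balaban1983to89.T4BoundaryCarrier
  (BFunctional atFl NE9Fl DecayBoundFl CouplingFree ne9Fl_of_couplingFree)
open Summit.QuantumFields.BalabanUV.T4Continuum.NE9LastCouplingBridge
open Summit.QuantumFields.BalabanUV.T4Continuum.NE9BridgeSizeInduction

/-! ## §1 Sub-windows: the node-U3 shapes are antitone in the window -/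

section SubWindow

variable {C : T4OutputRate.Carriers} {Bg : Type}

/-- The coupling window `]0, γ]^ℕ` grows with its ceiling: `γ′ ≤ γ ⇒ Window γ′ ⊆ Window γ`. [folklore] -/
theorem window_mono {γ γ' : ℝ} (h : γ' ≤ γ) : Window γ' ⊆ Window γ :=
  fun _ hg i => ⟨(hg i).1, (hg i).2.trans h⟩

/-- On the window every coordinate power is below the ceiling's power: `g ∈ Window γ ⇒ (g j)^{κ₀} ≤ γ^{κ₀}` (natural
exponent, as in (2.31)'s `g_j^{κ₀}` with `κ₀` *"arbitrarily large"*). [folklore] -/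
theorem pow_le_of_mem_window {γ : ℝ} {g : ℕ → ℝ} (hg : g ∈ Window γ) (κ₀ j : ℕ) : g j ^ κ₀ ≤ γ ^ κ₀ :=
  pow_le_pow_left₀ (hg j).1.le (hg j).2 κ₀

/-- Real-exponent form: `g ∈ Window γ`, `0 ≤ κ₀ ⇒ (g j)^{κ₀} ≤ γ^{κ₀}`. [folklore] -/
theorem rpow_le_of_mem_window {γ : ℝ} {g : ℕ → ℝ} (hg : g ∈ Window γ) {κ₀ : ℝ} (hκ₀ : 0 ≤ κ₀) (j : ℕ) :
    g j ^ κ₀ ≤ γ ^ κ₀ :=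
  Real.rpow_le_rpow (hg j).1.le (hg j).2 hκ₀

/-- A window is nonempty only if its ceiling is positive. [folklore] -/
theorem ceiling_pos_of_mem_window {γ : ℝ} {g : ℕ → ℝ} (hg : g ∈ Window γ) : 0 < γ :=
  (hg 0).1.trans_le (hg 0).2

/-- `DecayBound` is antitone in the window. [folklore] -/
theorem decayBound_anti {E : Functional C Bg} {W W' : Set (ℕ → ℝ)} {E₀ κ : ℝ} (hW : W' ⊆ W)
    (h : DecayBound E W E₀ κ) : DecayBound E W' E₀ κ :=
  fun g hg U X => h g (hW hg) U X

/-- `NE9` is antitone in the window: a sub-window inherits the history moduli. [folklore] -/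
theorem ne9_anti {E : Functional C Bg} {W W' : Set (ℕ → ℝ)} {κ : ℝ} {Λ : ℕ → ℕ → ℝ} (hW : W' ⊆ W)
    (h : NE9 E W κ Λ) : NE9 E W' κ Λ :=
  fun g hg g' hg' U X => h g (hW hg) g' (hW hg') U X

/-- `NE9` is monotone in the history moduli (only the entries `Λ k i`, `i < k`, are read). [folklore] -/
theorem ne9_mono_moduli {E : Functional C Bg} {W : Set (ℕ → ℝ)} {κ : ℝ} {Λ Λ' : ℕ → ℕ → ℝ}
    (hΛ : ∀ k, ∀ i < k, Λ k i ≤ Λ' k i) (h : NE9 E W κ Λ) : NE9 E W κ Λ' := by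
  intro g hg g' hg' U X
  refine (h g hg g' hg' U X).trans ?_
  refine mul_le_mul_of_nonneg_left (Finset.sum_le_sum fun i hi => ?_) (Real.exp_pos _).le
  exact mul_le_mul_of_nonneg_right (hΛ _ i (Finset.mem_range.mp hi)) (abs_nonneg _)

/-- `FadingMemory` is monotone in the amplitude. [folklore] -/
theorem fadingMemory_mono_amplitude {C₉ C₉' ω : ℝ} {Λ : ℕ → ℕ → ℝ} (hC : C₉ ≤ C₉') (hω : 0 ≤ ω)
    (h : FadingMemory C₉ ω Λ) : FadingMemory C₉' ω Λ :=
  fun k i hik => ⟨(h k i hik).1, (h k i hik).2.trans (mul_le_mul_of_nonneg_right hC (pow_nonneg hω _))⟩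

variable {C' : T4BoundaryCarrier.Carriers} {Bg' : Type}

/-- `NE9Fl` (NE9 at every admissible pending field) is antitone in the window. [folklore] -/
theorem ne9Fl_anti {B : BFunctional C' Bg'} {W W' : Set (ℕ → ℝ)} {κ : ℝ} {Λ : ℕ → ℕ → ℝ} (hW : W' ⊆ W)
    (h : NE9Fl B W κ Λ) : NE9Fl B W' κ Λ :=
  fun f hf => ne9_anti hW (h f hf)

/-- `NE9Fl` is monotone in the history moduli. [folklore] -/
theorem ne9Fl_mono_moduli {B : BFunctional C' Bg'} {W : Set (ℕ → ℝ)} {κ : ℝ} {Λ Λ' : ℕ → ℕ → ℝ}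
    (hΛ : ∀ k, ∀ i < k, Λ k i ≤ Λ' k i) (h : NE9Fl B W κ Λ) : NE9Fl B W κ Λ' :=
  fun f hf => ne9_mono_moduli hΛ (h f hf)

/-- `DecayBoundFl` is antitone in the window. [folklore] -/
theorem decayBoundFl_anti {B : BFunctional C' Bg'} {W W' : Set (ℕ → ℝ)} {B₀ κ : ℝ} (hW : W' ⊆ W)
    (h : DecayBoundFl B W B₀ κ) : DecayBoundFl B W' B₀ κ :=
  fun f hf => decayBound_anti hW (h f hf)

end SubWindow

/-! ## §2 The g_j^{κ₀}-weighted (R-type) dictionary on a window: «E₀ ↦ R₁γ^{κ₀}» -/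

section Weighted

variable {C : T4OutputRate.Carriers} {Bg : Type}

/-- **(2.31)-TYPE SIZE ⇒ `DecayBound` ON A WINDOW.**  HYPOTHESIS SHAPE (never asserted): a g_{scale X}^{κ₀}-weighted size
`|R g U X| ≤ R₁·(g (scale X))^{κ₀}·e^{−κd(X)}` on a set of histories inside `Window γ`.  Then the printed-form decay bound
`T4OutputRate.DecayBound R W (R₁·γ^{κ₀}) κ` holds — the constant `E₀ ↦ R₁γ^{κ₀}` of skeleton P2 §4 F7; on a sub-window
`Window γ′ ∩ W` the same lemma gives `R₁γ′^{κ₀}`. [folklore] -/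
theorem decayBound_of_powWeighted {R : Functional C Bg} {W : Set (ℕ → ℝ)} {γ R₁ κ : ℝ} {κ₀ : ℕ}
    (hW : W ⊆ Window γ) (hR₁ : 0 ≤ R₁)
    (h : ∀ g ∈ W, ∀ (U : Bg) (X : C.Dom), |R g U X| ≤ R₁ * g (C.scale X) ^ κ₀ * Real.exp (-(κ * C.d X))) :
    DecayBound R W (R₁ * γ ^ κ₀) κ := by
  intro g hg U X
  refine (h g hg U X).trans ?_
  have hγ := pow_le_of_mem_window (hW hg) κ₀ (C.scale X)
  gcongr

/-- Real-exponent form of `decayBound_of_powWeighted` (`κ₀ : ℝ`, `0 ≤ κ₀`). [folklore] -/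
theorem decayBound_of_rpowWeighted {R : Functional C Bg} {W : Set (ℕ → ℝ)} {γ R₁ κ κ₀ : ℝ}
    (hW : W ⊆ Window γ) (hR₁ : 0 ≤ R₁) (hκ₀ : 0 ≤ κ₀)
    (h : ∀ g ∈ W, ∀ (U : Bg) (X : C.Dom), |R g U X| ≤ R₁ * g (C.scale X) ^ κ₀ * Real.exp (-(κ * C.d X))) :
    DecayBound R W (R₁ * γ ^ κ₀) κ := by
  intro g hg U X
  refine (h g hg U X).trans ?_
  have hγ := rpow_le_of_mem_window (hW hg) hκ₀ (C.scale X)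
  gcongr

/-- **(X)-BINDER OF THE OCCUPATION-FREE END FROM A WEIGHTED EXPLICIT SIZE.**  If the explicit (coupling-carrying) part of the
step-k new term has the g_k^{κ₀}-weighted size `|expl k (g k) U X| ≤ e^{−κd(X)}·(R₁ k·(g k)^{κ₀})` on a window inside
`Window γ`, then the g-UNIFORM binder `hexplSize` of `NE9BridgeSizeInduction.ne9_and_fadingMemory_of_couplingTwoPoint_
sizeInduction` holds with `p₀ k := R₁ k·γ^{κ₀}` — LITERALLY its shape. [folklore] -/
theorem explSize_of_powWeighted {W : Set (ℕ → ℝ)} {γ κ : ℝ} {κ₀ : ℕ} {R₁ : ℕ → ℝ}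
    {expl : ℕ → ℝ → Bg → C.Dom → ℝ} (hW : W ⊆ Window γ) (hR₁ : ∀ k, 0 ≤ R₁ k)
    (h : ∀ g ∈ W, ∀ (k : ℕ) (U : Bg) (X : C.Dom), C.scale X = k + 1 →
      |expl k (g k) U X| ≤ Real.exp (-(κ * C.d X)) * (R₁ k * g k ^ κ₀)) :
    ∀ g ∈ W, ∀ (k : ℕ) (U : Bg) (X : C.Dom), C.scale X = k + 1 →
      |expl k (g k) U X| ≤ Real.exp (-(κ * C.d X)) * (R₁ k * γ ^ κ₀) := by
  intro g hg k U X hX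
  refine (h g hg k U X hX).trans ?_
  have hγ := pow_le_of_mem_window (hW hg) κ₀ k
  have := hR₁ k
  gcongr

/-- **(B0)-BINDER FROM A WEIGHTED BASE SIZE.**  A g_0^{κ₀}-weighted size of the scale-0 terms on a window inside `Window γ`
gives the g-UNIFORM base binder `hbase` of the occupation-free END with `N 0 := R₁·γ^{κ₀}` — LITERALLY its shape.
[folklore] -/
theorem baseSize_of_powWeighted {E : Functional C Bg} {W : Set (ℕ → ℝ)} {γ κ R₁ : ℝ} {κ₀ : ℕ}
    (hW : W ⊆ Window γ) (hR₁ : 0 ≤ R₁)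
    (h : ∀ g ∈ W, ∀ (U : Bg) (X : C.Dom), C.scale X = 0 →
      |E g U X| ≤ Real.exp (-(κ * C.d X)) * (R₁ * g 0 ^ κ₀)) :
    ∀ g ∈ W, ∀ (U : Bg) (X : C.Dom), C.scale X = 0 → |E g U X| ≤ Real.exp (-(κ * C.d X)) * (R₁ * γ ^ κ₀) := by
  intro g hg U X hX
  refine (h g hg U X hX).trans ?_
  have hγ := pow_le_of_mem_window (hW hg) κ₀ 0
  gcongr

/-- **g-WEIGHTED HISTORY MODULI MAJORISED ON THE WINDOW GIVE `NE9`.**  HYPOTHESIS SHAPE (never asserted): a joint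
coupling-Lipschitz bound whose moduli `Λg g g′ k i` may depend on the two histories (the natural form for g_j^{κ₀}-weighted
R-type terms — skeleton P2 §5 (g4)), together with a uniform majorant `Λ` of those moduli on the window, gives the typed
(g-independent) `T4OutputRate.NE9 E W κ Λ`. [folklore] -/
theorem ne9_of_weightedModuli {E : Functional C Bg} {W : Set (ℕ → ℝ)} {κ : ℝ}
    {Λg : (ℕ → ℝ) → (ℕ → ℝ) → ℕ → ℕ → ℝ} {Λ : ℕ → ℕ → ℝ}
    (h : ∀ g ∈ W, ∀ g' ∈ W, ∀ (U : Bg) (X : C.Dom),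
      |E g U X - E g' U X| ≤
        Real.exp (-(κ * C.d X)) * ∑ i ∈ Finset.range (C.scale X), Λg g g' (C.scale X) i * |g i - g' i|)
    (hΛ : ∀ g ∈ W, ∀ g' ∈ W, ∀ k, ∀ i < k, Λg g g' k i ≤ Λ k i) : NE9 E W κ Λ := by
  intro g hg g' hg' U X
  refine (h g hg g' hg' U X).trans ?_
  refine mul_le_mul_of_nonneg_left (Finset.sum_le_sum fun i hi => ?_) (Real.exp_pos _).le
  exact mul_le_mul_of_nonneg_right (hΛ g hg g' hg' _ i (Finset.mem_range.mp hi)) (abs_nonneg _)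

/-- The weighted-moduli instance actually met by R-type families: moduli `(g′ (k−1))^{κ₀}·Λ k i` (a power of the LAST
coupling of one of the two histories times a fixed profile, `0 ≤ Λ`) on a window inside `Window γ` give `NE9` with the
uniform moduli `γ^{κ₀}·Λ k i`. [folklore] -/
theorem ne9_of_lastPowWeightedModuli {E : Functional C Bg} {W : Set (ℕ → ℝ)} {γ κ : ℝ} {κ₀ : ℕ} {Λ : ℕ → ℕ → ℝ}
    (hW : W ⊆ Window γ) (hΛ : ∀ k i, 0 ≤ Λ k i)
    (h : ∀ g ∈ W, ∀ g' ∈ W, ∀ (U : Bg) (X : C.Dom),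
      |E g U X - E g' U X| ≤
        Real.exp (-(κ * C.d X)) *
          ∑ i ∈ Finset.range (C.scale X), g' (C.scale X - 1) ^ κ₀ * Λ (C.scale X) i * |g i - g' i|) :
    NE9 E W κ (fun k i => γ ^ κ₀ * Λ k i) := by
  refine ne9_of_weightedModuli (Λg := fun _ g' k i => g' (k - 1) ^ κ₀ * Λ k i) h ?_
  intro g _ g' hg' k i _
  exact mul_le_mul_of_nonneg_right (pow_le_of_mem_window (hW hg') κ₀ (k - 1)) (hΛ k i)

end Weighted

/-! ## §3 Boundary families: the row's ENDs at every admissible pending field -/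

section Boundary

variable {C : T4BoundaryCarrier.Carriers} (G : ClusterGeom C.toCarriers) {Bg : Type} {Pot : Type*}
  [NormedAddCommGroup Pot]

/-- **BOUNDARY FAMILY, generic form.**  `NE9` with the geometric product moduli `ℓ·μ^{k−1−i}` AT EVERY ADMISSIBLE PENDING
FIELD is `NE9Fl` with those moduli, and their fading-memory profile `FadingMemory (ℓ/μ) μ` is a property of the numbers
(ℓ ≥ 0, μ > 0) alone (`fadingMemory_geometric`) — the pair consumed by `T4TermwiseBoundary` (`h9`, `hΛ`). [folklore] -/
theorem ne9Fl_and_fadingMemory_of_forall {B : BFunctional C Bg} {W : Set (ℕ → ℝ)} {κ ℓ μ : ℝ} (hℓ : 0 ≤ ℓ)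
    (hμ : 0 < μ) (h : ∀ f ∈ C.admFl, NE9 (atFl B f) W κ (prodModuli ℓ fun _ => μ)) :
    NE9Fl B W κ (prodModuli ℓ fun _ => μ) ∧ FadingMemory (ℓ / μ) μ (prodModuli ℓ fun _ => μ) :=
  ⟨h, fadingMemory_geometric hℓ hμ⟩

/-- **THE ROW'S ROOT END APPLIED TO A BOUNDARY FAMILY** (`NE9LastCouplingBridge.ne9_and_fadingMemory_of_couplingTwoPoint`
at each admissible pending field `f`; skeleton P2 §4 F7 / `T4HistoryLipschitzRecursion` header «applying the theorems to
`atFl B a` at each admissible pending field»).  The one-step model data — admissible class `Adm f`, channel `T f`,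
new-term map `Ψ f`, activities `act f`, admissible tables `𝒜 f`, majorant `n f`, reading `ρ f`, explicit part `expl f` —
may depend on the pending field; the geometry `G`, the weights `wt`, `τ` and ALL CONSTANTS are uniform in it (the printed
situation of (2.42) p. 261 of [III]: the bound of a boundary piece is uniform in the pending field A).  Every binder of the
END is displayed per pending field, VERBATIM; one extra scalar `0 ≤ lipbar` (in the END a consequence of `TwoPointKP`,
unavailable when `admFl = ∅`).  Conclusion LITERALLY `NE9Fl Bd W κ (prodModuli ℓ (fun _ => ω′)) ∧ FadingMemory (ℓ/ω′) ω′ (…)`,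
`ℓ = 4·clipbar·B + pexbar + 4·lipbar·B·qTbar`, `ω′ = ω + 4·lipbar·B·τ̄`.  Discharges nothing; NE9 NOT proved.
[cite: Balaban1988Convergent, (2.41)-(2.42) p.261] -/
theorem ne9Fl_and_fadingMemory_of_couplingTwoPoint_atFl [NormedSpace ℂ Pot] {ι : Type} {Bd : BFunctional C Bg}
    {W : Set (ℕ → ℝ)} {Adm : C.Fl → Set (Bg → C.Dom → ℝ)}
    {T : C.Fl → ℕ → (ℕ → ℝ) → (Bg → C.Dom → ℝ) → ι → ℝ}
    {Ψ : C.Fl → ℕ → ℝ → (ι → ℝ) → Bg → C.Dom → ℝ} {act : C.Fl → ℕ → ℝ → Bg → Pot → G.P → ℂ}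
    {𝒜 : C.Fl → ℕ → Set Pot} {n : C.Fl → ℕ → ℝ → Bg → G.P → ℝ} {lip clip : ℕ → ℝ} {a d : G.P → ℝ}
    {δ : C.Dom → ℝ} {κ B lipbar clipbar pexbar qTbar τbar ω : ℝ} {wt : ℕ → ι → ℝ} {τ : ℕ → ℕ → ℝ}
    {pex qT : ℕ → ℝ} (ρ : C.Fl → ℕ → (ι → ℝ) → Pot) (expl : C.Fl → ℕ → ℝ → Bg → C.Dom → ℝ)
    (h0 : ∀ f ∈ C.admFl, ScaleZeroFree (atFl Bd f) W)
    (hAdm : ∀ f ∈ C.admFl, AdmissibleTerms (atFl Bd f) W (Adm f)) (hres : ∀ f ∈ C.admFl, AdmRestrict (Adm f))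
    (hadd : ∀ f ∈ C.admFl, ChannelAdditive (Adm f) (T f)) (hsum : ∀ f ∈ C.admFl, ChannelStepSum (Adm f) (T f))
    (hstep : ∀ f ∈ C.admFl, ChannelSizeAtStepNN (Adm f) (T f) κ wt τ)
    (hfac : ∀ f ∈ C.admFl, Factorises (atFl Bd f) W (T f) (Ψ f))
    -- the coupling channel, per pending field: COUPLING TWO-POINT and CHANNEL COUPLING MODULUS
    (hclip0 : ∀ k, 0 ≤ clip k)
    (hCup : ∀ f ∈ C.admFl, ∀ g ∈ W, ∀ g' ∈ W, ∀ (k : ℕ) (U : Bg) (X : C.Dom), C.scale X = k + 1 →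
      ∀ Q ∈ 𝒜 f k, ∀ γ ∈ G.vol X,
        ‖act f k (g k) U Q γ‖ ≤ n f k (g' k) U γ ∧
          ‖act f k (g k) U Q γ - act f k (g' k) U Q γ‖ ≤ clip k * |g k - g' k| * n f k (g' k) U γ)
    (hqT0 : ∀ k, 0 ≤ qT k)
    (hTcup : ∀ f ∈ C.admFl, ∀ g ∈ W, ∀ g' ∈ W, ∀ (k : ℕ) (y : ι),
      |T f k g (atFl Bd f g) y - T f k g' (atFl Bd f g) y| ≤ wt k y * (qT k * |g k - g' k|))
    (hrepr : ∀ f ∈ C.admFl, ∀ (k : ℕ) (s : ℝ) (P : ι → ℝ) (U : Bg) (X : C.Dom),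
      Ψ f k s P U X = (G.newTerm (act f) k s U X (ρ f k P)).re + expl f k s U X)
    (hexpl : ∀ f ∈ C.admFl, ∀ g ∈ W, ∀ g' ∈ W, ∀ (k : ℕ) (U : Bg) (X : C.Dom), C.scale X = k + 1 →
      |expl f k (g k) U X - expl f k (g' k) U X| ≤ Real.exp (-(κ * C.d X)) * (pex k * |g k - g' k|))
    (hclipb : ∀ k, clip k ≤ clipbar) (hpexb : ∀ k, pex k ≤ pexbar) (hpexbar : 0 ≤ pexbar) (hqTb : ∀ k, qT k ≤ qTbar)
    -- the table channel and the common data (P2), per pending field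
    (hK : ∀ f ∈ C.admFl, TwoPointKP G W (act f) (𝒜 f) (n f) lip a d) (hdec : G.DecayExtract δ d)
    (hpin : G.PinBudget a δ (fun _ => B) κ)
    (hρ : ∀ f ∈ C.admFl, ∀ (k : ℕ) (P P' : ι → ℝ) (M : ℝ),
      (∀ y, |P y - P' y| ≤ wt k y * M) → ‖ρ f k P - ρ f k P'‖ ≤ M)
    (hocc : ∀ f ∈ C.admFl, ∀ g ∈ W, ∀ g' ∈ W, ∀ k : ℕ, ρ f k (T f k g' (atFl Bd f g)) ∈ 𝒜 f k) (hB : 0 ≤ B)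
    (hlipbar : 0 ≤ lipbar) (hlipb : ∀ k, lip k ≤ lipbar) (hτbar : 0 ≤ τbar) (hω : 0 ≤ ω)
    (hpos : 0 < ω + 4 * lipbar * B * τbar) (hτ : ∀ k j, j ≤ k → 0 ≤ τ k j ∧ τ k j ≤ τbar * ω ^ (k - j)) :
    NE9Fl Bd W κ (prodModuli (4 * clipbar * B + pexbar + 4 * lipbar * B * qTbar) fun _ => ω + 4 * lipbar * B * τbar) ∧
      FadingMemory ((4 * clipbar * B + pexbar + 4 * lipbar * B * qTbar) / (ω + 4 * lipbar * B * τbar))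
        (ω + 4 * lipbar * B * τbar)
        (prodModuli (4 * clipbar * B + pexbar + 4 * lipbar * B * qTbar) fun _ => ω + 4 * lipbar * B * τbar) := by
  have hclipbar : 0 ≤ clipbar := (hclip0 0).trans (hclipb 0)
  have hqTbar : 0 ≤ qTbar := (hqT0 0).trans (hqTb 0)
  refine ne9Fl_and_fadingMemory_of_forall (by positivity) hpos fun f hf => ?_
  exact (ne9_and_fadingMemory_of_couplingTwoPoint G (ρ f) (expl f) (h0 f hf) (hAdm f hf) (hres f hf) (hadd f hf)
    (hsum f hf) (hstep f hf) (hfac f hf) hclip0 (hCup f hf) hqT0 (hTcup f hf) (hrepr f hf) (hexpl f hf) hclipb hpexb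
    hpexbar hqTb (hK f hf) hdec hpin (hρ f hf) (hocc f hf) hB hlipb hτbar hω hpos hτ).1

/-- **THE OCCUPATION-FREE END APPLIED TO A BOUNDARY FAMILY** (`NE9BridgeSizeInduction.ne9_and_fadingMemory_of_
couplingTwoPoint_sizeInduction` at each admissible pending field): as above with the occupation `hocc` REPLACED by the
size-induction data (B0) `hbase`, (X) `hexplSize`, (N) `p₀ j + B ≤ N (j+1)`, `hNnn`, (R′) `hbox`, per pending field, the
size profiles `p₀`, `N` uniform in the pending field ((2.42) is uniform in A; for a g_j^{κ₀}-weighted explicit size use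
`explSize_of_powWeighted` / `baseSize_of_powWeighted` of §2 first).  Conclusion: the term size bound at every admissible
pending field, `NE9Fl` with the END's moduli, and their fading-memory profile.  Discharges nothing; NE9 NOT proved.
[cite: Balaban1988Convergent, (2.41)-(2.42) p.261] -/
theorem ne9Fl_and_fadingMemory_of_couplingTwoPoint_sizeInduction_atFl [NormedSpace ℂ Pot] {ι : Type}
    {Bd : BFunctional C Bg} {W : Set (ℕ → ℝ)} {Adm : C.Fl → Set (Bg → C.Dom → ℝ)}
    {T : C.Fl → ℕ → (ℕ → ℝ) → (Bg → C.Dom → ℝ) → ι → ℝ}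
    {Ψ : C.Fl → ℕ → ℝ → (ι → ℝ) → Bg → C.Dom → ℝ} {act : C.Fl → ℕ → ℝ → Bg → Pot → G.P → ℂ}
    {𝒜 : C.Fl → ℕ → Set Pot} {n : C.Fl → ℕ → ℝ → Bg → G.P → ℝ} {lip clip : ℕ → ℝ} {a d : G.P → ℝ}
    {δ : C.Dom → ℝ} {κ B lipbar clipbar pexbar qTbar τbar ω : ℝ} {wt : ℕ → ι → ℝ} {τ : ℕ → ℕ → ℝ}
    {pex qT p₀ N : ℕ → ℝ} (ρ : C.Fl → ℕ → (ι → ℝ) → Pot) (expl : C.Fl → ℕ → ℝ → Bg → C.Dom → ℝ)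
    (h0 : ∀ f ∈ C.admFl, ScaleZeroFree (atFl Bd f) W)
    (hAdm : ∀ f ∈ C.admFl, AdmissibleTerms (atFl Bd f) W (Adm f)) (hres : ∀ f ∈ C.admFl, AdmRestrict (Adm f))
    (hadd : ∀ f ∈ C.admFl, ChannelAdditive (Adm f) (T f)) (hsum : ∀ f ∈ C.admFl, ChannelStepSum (Adm f) (T f))
    (hstep : ∀ f ∈ C.admFl, ChannelSizeAtStepNN (Adm f) (T f) κ wt τ)
    (hfac : ∀ f ∈ C.admFl, Factorises (atFl Bd f) W (T f) (Ψ f))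
    (hclip0 : ∀ k, 0 ≤ clip k)
    (hCup : ∀ f ∈ C.admFl, ∀ g ∈ W, ∀ g' ∈ W, ∀ (k : ℕ) (U : Bg) (X : C.Dom), C.scale X = k + 1 →
      ∀ Q ∈ 𝒜 f k, ∀ γ ∈ G.vol X,
        ‖act f k (g k) U Q γ‖ ≤ n f k (g' k) U γ ∧
          ‖act f k (g k) U Q γ - act f k (g' k) U Q γ‖ ≤ clip k * |g k - g' k| * n f k (g' k) U γ)
    (hqT0 : ∀ k, 0 ≤ qT k)
    (hTcup : ∀ f ∈ C.admFl, ∀ g ∈ W, ∀ g' ∈ W, ∀ (k : ℕ) (y : ι),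
      |T f k g (atFl Bd f g) y - T f k g' (atFl Bd f g) y| ≤ wt k y * (qT k * |g k - g' k|))
    (hrepr : ∀ f ∈ C.admFl, ∀ (k : ℕ) (s : ℝ) (P : ι → ℝ) (U : Bg) (X : C.Dom),
      Ψ f k s P U X = (G.newTerm (act f) k s U X (ρ f k P)).re + expl f k s U X)
    (hexpl : ∀ f ∈ C.admFl, ∀ g ∈ W, ∀ g' ∈ W, ∀ (k : ℕ) (U : Bg) (X : C.Dom), C.scale X = k + 1 →
      |expl f k (g k) U X - expl f k (g' k) U X| ≤ Real.exp (-(κ * C.d X)) * (pex k * |g k - g' k|))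
    (hclipb : ∀ k, clip k ≤ clipbar) (hpexb : ∀ k, pex k ≤ pexbar) (hpexbar : 0 ≤ pexbar) (hqTb : ∀ k, qT k ≤ qTbar)
    (hK : ∀ f ∈ C.admFl, TwoPointKP G W (act f) (𝒜 f) (n f) lip a d) (hdec : G.DecayExtract δ d)
    (hpin : G.PinBudget a δ (fun _ => B) κ)
    (hρ : ∀ f ∈ C.admFl, ∀ (k : ℕ) (P P' : ι → ℝ) (M : ℝ),
      (∀ y, |P y - P' y| ≤ wt k y * M) → ‖ρ f k P - ρ f k P'‖ ≤ M)
    -- the size-induction data (B0), (X), (N), (R′), per pending field — in place of `hocc`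
    (hexplSize : ∀ f ∈ C.admFl, ∀ g ∈ W, ∀ (k : ℕ) (U : Bg) (X : C.Dom), C.scale X = k + 1 →
      |expl f k (g k) U X| ≤ Real.exp (-(κ * C.d X)) * p₀ k)
    (hbase : ∀ f ∈ C.admFl, ∀ g ∈ W, ∀ (U : Bg) (X : C.Dom), C.scale X = 0 →
      |atFl Bd f g U X| ≤ Real.exp (-(κ * C.d X)) * N 0)
    (hNsucc : ∀ j, p₀ j + B ≤ N (j + 1)) (hNnn : ∀ j, 0 ≤ N j)
    (hbox : ∀ f ∈ C.admFl, ∀ (k : ℕ) (P : ι → ℝ), (∀ y, |P y| ≤ wt k y * sizeRadius τ N k) → ρ f k P ∈ 𝒜 f k)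
    (hB : 0 ≤ B) (hlipbar : 0 ≤ lipbar) (hlipb : ∀ k, lip k ≤ lipbar) (hτbar : 0 ≤ τbar) (hω : 0 ≤ ω)
    (hpos : 0 < ω + 4 * lipbar * B * τbar) (hτ : ∀ k j, j ≤ k → 0 ≤ τ k j ∧ τ k j ≤ τbar * ω ^ (k - j)) :
    (∀ f ∈ C.admFl, TermSize (atFl Bd f) W κ N) ∧
      NE9Fl Bd W κ
          (prodModuli (4 * clipbar * B + pexbar + 4 * lipbar * B * qTbar) fun _ => ω + 4 * lipbar * B * τbar) ∧
        FadingMemory ((4 * clipbar * B + pexbar + 4 * lipbar * B * qTbar) / (ω + 4 * lipbar * B * τbar))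
          (ω + 4 * lipbar * B * τbar)
          (prodModuli (4 * clipbar * B + pexbar + 4 * lipbar * B * qTbar) fun _ => ω + 4 * lipbar * B * τbar) := by
  have hclipbar : 0 ≤ clipbar := (hclip0 0).trans (hclipb 0)
  have hqTbar : 0 ≤ qTbar := (hqT0 0).trans (hqTb 0)
  have hface : ∀ f ∈ C.admFl, TermSize (atFl Bd f) W κ N ∧
      NE9 (atFl Bd f) W κ
        (prodModuli (4 * clipbar * B + pexbar + 4 * lipbar * B * qTbar) fun _ => ω + 4 * lipbar * B * τbar) :=
    fun f hf =>
    let h := ne9_and_fadingMemory_of_couplingTwoPoint_sizeInduction G (ρ f) (expl f) (h0 f hf) (hAdm f hf) (hres f hf)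
      (hadd f hf) (hsum f hf) (hstep f hf) (hfac f hf) hclip0 (hCup f hf) hqT0 (hTcup f hf) (hrepr f hf) (hexpl f hf)
      hclipb hpexb hpexbar hqTb (hK f hf) hdec hpin (hρ f hf) (hexplSize f hf) (hbase f hf) hNsucc hNnn (hbox f hf) hB
      hlipb hτbar hω hpos hτ
    ⟨h.1, h.2.1⟩
  exact ⟨fun f hf => (hface f hf).1,
    ne9Fl_and_fadingMemory_of_forall (by positivity) hpos fun f hf => (hface f hf).2⟩

end Boundary

/-! ## §4 Non-vacuity of the conclusion shape -/

section NonVacuity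

/-- The conclusion shape of §3 is inhabited: a COUPLING-FREE boundary family (`T4BoundaryCarrier.CouplingFree`, the
degenerate instance recorded by that module) satisfies `NE9Fl` with the END's product moduli for ANY nonnegative ℓ and
positive rate, together with their fading-memory profile — so no consumer hypothesis list built from the pair is
contradictory by shape alone.  (A witness with non-trivial history dependence is crew item (w1), `NE9BridgeWitness`, of
another seat; P2's `T4HistoryLipschitzWitness` is the non-vacuity control of the END's own binders.) [folklore] -/
theorem ne9Fl_and_fadingMemory_of_couplingFree {C : T4BoundaryCarrier.Carriers} {Bg : Type} {B : BFunctional C Bg}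
    {W : Set (ℕ → ℝ)} (hB : CouplingFree B W) (κ : ℝ) {ℓ μ : ℝ} (hℓ : 0 ≤ ℓ) (hμ : 0 < μ) :
    NE9Fl B W κ (prodModuli ℓ fun _ => μ) ∧ FadingMemory (ℓ / μ) μ (prodModuli ℓ fun _ => μ) :=
  ⟨ne9Fl_of_couplingFree hB κ (prodModuli_nonneg hℓ fun _ => hμ.le), fadingMemory_geometric hℓ hμ⟩

/-- Concretely: on the one-point boundary carrier every constant family is coupling-free, hence satisfies the pair with,
e.g., `ℓ = 1`, rate `1/2` (fading). [folklore] -/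
example : ∃ (C : T4BoundaryCarrier.Carriers) (B : BFunctional C Unit),
    NE9Fl B (Window 1) 1 (prodModuli 1 fun _ => (1 / 2 : ℝ)) ∧
      FadingMemory (1 / (1 / 2)) (1 / 2) (prodModuli 1 fun _ => (1 / 2 : ℝ)) := by
  refine ⟨⟨⟨Unit, fun _ => 0, fun _ => 0, fun _ => le_rfl, Unit, Unit, fun _ _ => 0, fun _ _ => le_rfl, fun _ => ()⟩,
    Unit, Set.univ⟩, fun _ _ _ _ => 0, ?_⟩
  exact ne9Fl_and_fadingMemory_of_couplingFree (fun _ _ _ _ _ _ _ _ => rfl) 1 zero_le_one (by norm_num)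

end NonVacuity

end Summit.QuantumFields.BalabanUV.T4Continuum.NE9BoundaryFamily
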